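import Summits.CriticalPhenomena.PercolationContinuityZ3.Theorems.Transplant.PlanarSkeletonFrmCylKit
import HarnessLib

/-!
# Φ2 at the interface level, XV: RAY ESCAPES — outward step maps, rays in the big cylinder, their tails, north/east disjointness
# (any `PlanarSkeletonFrm`, ANY number of types, no further input)

builds on p205010 (kernel theorem, internal audit signed; external expert review pending) — nothing in this file uses p205010; nothing
here is a claim about any open node.
Lane `prim-bschramm`, seat `prim-bschramm-p4` gen 15 (PART C3 of `P4-GENERAL.md`, §37).  Helper file
(`--supports stmt-CriticalPhenomena-4575 --as helper`).  No probability.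

The column method for Φ2 (files I–XIV) partitioned the big cylinder `G[C_{ℓ+3}(t)]` into finite CLASSES (one type: Hall matching; several
types: escape data, which can fail to exist as forests).  The class structure was consumed at exactly one place: the dichotomy "each kit
column inside or outside the region" of `CycleKit.exists_routeData_of_pivotal`.  File `SubgraphLocModCycleC` replaced the dichotomy by TAIL
conditions, which UP-CLOSED regions supply.  This file provides the combinatorics for every `PlanarSkeletonFrm` — using only (ι) unit steps and
the Lipschitz property:
* `stp i` — a fixed outward unit step `v ↦ v'`, `φ v' = φ v + eᵢ` (choice from (ι)); `stpC` — the same on the big cylinder (identity off `Λ_{ℓ+2}`);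
* `exists_rayWalk` / `exists_rayC` — the RAY `x, stp x, stp² x, …` of an inner vertex in direction `eᵢ` until it leaves `Λ_ℓ`: a path in the big cylinder of
  length `≤ 2ℓ+1`, inside `Λ_{ℓ+1}`, ending outside `Λ_ℓ`, all other vertices inside `Λ_ℓ`, whose vertices other than `x` sit at
  `φ x + j eᵢ`, `j ≥ 1`, and whose TAILS
  above any vertex of an up-closed set stay in that set;
* `ray_disjoint` — the NORTH ray (`e₁`) of `a` and the EAST ray (`e₀`) of `b` are vertex-disjoint as soon as `φ₀ a < φ₀ b`, or
  `φ₁ b < φ₁ a`, or `φ a = φ b ∧ a ≠ b`; `north_cases` — for a pair `{x, y}` one of the two orders always qualifies;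
Sequels: XVI (`PlanarSkeletonFrmRayHull`: finite up-closed hulls), XVII (`PlanarSkeletonFrmRayStrict`: kits with ray columns, regions =
hulls, `p_c(G) < p_c(C_ℓ(t))` and Φ2 at `p_c` for EVERY frames-only skeleton).
[cite: AizenmanGrimmett1991, Thm 1 (essential enhancements)] [cite: KozmaNitzan2024, §4 p. 26 ((29))]
-/

noncomputable section

namespace Summit.CriticalPhenomena.PercolationContinuityZ3.Theorems.Transplant

namespace PlanarSkeletonFrm

open SimpleGraph Walk Literature.Probability.LatticeModels
open scoped Classical

variable {V : Type} {G : SimpleGraph V} [G.LocallyFinite] (Φ : PlanarSkeletonFrm G)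

/-! ## §1 The outward step maps -/

/-- **A fixed outward unit step** in direction `eᵢ` (a choice from (ι)). [cite: KozmaNitzan2024, §4 p. 26 ((29))] -/
def stp (i : Fin 2) (v : V) : V := Classical.choose (Φ.step v i 1)

/-- The step is along an edge. [folklore] -/
theorem adj_stp (i : Fin 2) (v : V) : G.Adj v (Φ.stp i v) := (Classical.choose_spec (Φ.step v i 1)).1

/-- The step moves the skeleton position by `eᵢ`. [folklore] -/
theorem φ_stp (i : Fin 2) (v : V) : Φ.φ (Φ.stp i v) = Φ.φ v + Pi.single i 1 := by
  have h := (Classical.choose_spec (Φ.step v i 1)).2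
  rw [stp]
  simpa only [Units.val_one] using h

/-- The moving coordinate increases by one. [folklore] -/
theorem φ_stp_same (i : Fin 2) (v : V) : Φ.φ (Φ.stp i v) i = Φ.φ v i + 1 := by
  rw [Φ.φ_stp, Pi.add_apply, Pi.single_eq_same]

/-- The other coordinate is unchanged. [folklore] -/
theorem φ_stp_ne {i j : Fin 2} (h : j ≠ i) (v : V) : Φ.φ (Φ.stp i v) j = Φ.φ v j := by
  rw [Φ.φ_stp, Pi.add_apply, Pi.single_eq_of_ne h, add_zero]

section Cyl

variable {t : V} {ℓ : ℕ}

/-- **The step map on the big cylinder** `C_{ℓ+3}(t)`: the outward step on `Λ_{ℓ+2}`, the identity elsewhere. [folklore] -/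
def stpC (t : V) (ℓ : ℕ) (i : Fin 2) (v : Φ.cyl t (ℓ + 3)) : Φ.cyl t (ℓ + 3) :=
  if h : Φ.φ v.1 - Φ.φ t ∈ box 2 (ℓ + 2) then
    ⟨Φ.stp i v.1, by
      have h2 := mem_box_two.1 h
      simp only [Pi.sub_apply] at h2
      obtain ⟨h0, h1⟩ := h2
      rw [abs_le] at h0 h1
      push_cast at h0 h1
      rw [mem_cyl_two]
      constructor
      · by_cases hi : (0 : Fin 2) = i
        · subst hi; rw [Φ.φ_stp_same]; rw [abs_le]; push_cast; constructor <;> linarith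
        · rw [Φ.φ_stp_ne hi]; rw [abs_le]; push_cast; constructor <;> linarith
      · by_cases hi : (1 : Fin 2) = i
        · subst hi; rw [Φ.φ_stp_same]; rw [abs_le]; push_cast; constructor <;> linarith
        · rw [Φ.φ_stp_ne hi]; rw [abs_le]; push_cast; constructor <;> linarith⟩
  else v

/-- On `Λ_{ℓ+2}` the cylinder step is the step. [folklore] -/
theorem stpC_val (i : Fin 2) {v : Φ.cyl t (ℓ + 3)} (h : Φ.φ v.1 - Φ.φ t ∈ box 2 (ℓ + 2)) : (Φ.stpC t ℓ i v).1 = Φ.stp i v.1 := by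
  rw [stpC, dif_pos h]

/-- On `Λ_{ℓ+2}` the cylinder step is along an edge of the big cylinder graph. [folklore] -/
theorem adj_stpC (i : Fin 2) {v : Φ.cyl t (ℓ + 3)} (h : Φ.φ v.1 - Φ.φ t ∈ box 2 (ℓ + 2)) :
    (G.induce (Φ.cyl t (ℓ + 3))).Adj v (Φ.stpC t ℓ i v) := by
  show G.Adj v.1 (Φ.stpC t ℓ i v).1
  rw [Φ.stpC_val i h]; exact Φ.adj_stp i v.1

/-- A vertex of `Λ_ℓ` is a vertex of `Λ_{ℓ+2}`. [folklore] -/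
theorem mem_box_add_two_of_mem_box {z : Site 2} (h : z ∈ box 2 ℓ) : z ∈ box 2 (ℓ + 2) := by
  rw [mem_box] at h ⊢; intro i; have := h i; push_cast; constructor <;> linarith [this.1, this.2]

/-! ## §2 Ray walks -/

/-- `cons` past a different start does not change `dropUntil`. [folklore] -/
theorem dropUntil_cons_ne {H : SimpleGraph (Φ.cyl t (ℓ + 3))} {a b c u : Φ.cyl t (ℓ + 3)} (h : H.Adj a b) (p : H.Walk b c)
    (hu : u ∈ p.support) (hne : a ≠ u) :
    (Walk.cons h p).dropUntil u (List.mem_cons_of_mem _ hu) = p.dropUntil u hu := by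
  simp [Walk.dropUntil, hne]

/-- **THE RAY WALK** (`k` steps in direction `eᵢ` from `v`, staying in `Λ_ℓ` before the last vertex): a path of length `k` in the big
cylinder graph from `v` to `stpC^[k] v`; every support vertex is `v` or sits at `φ v + j eᵢ` with `1 ≤ j ≤ k`; and for every set `C`
closed under both step maps at vertices of `Λ_ℓ`, the tail of the walk above any of its `C`-vertices stays in `C`.
[cite: KozmaNitzan2024, §4 p. 26 ((29))] -/
theorem exists_rayWalk (i : Fin 2) : ∀ (k : ℕ) (v : Φ.cyl t (ℓ + 3)),
    (∀ j : Fin 2, j ≠ i → |Φ.φ v.1 j - Φ.φ t j| ≤ ℓ) → -(ℓ : ℤ) ≤ Φ.φ v.1 i - Φ.φ t i → Φ.φ v.1 i - Φ.φ t i + k ≤ (ℓ : ℤ) + 1 →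
    ∃ W : (G.induce (Φ.cyl t (ℓ + 3))).Walk v ((Φ.stpC t ℓ i)^[k] v), W.IsPath ∧ W.length = k ∧
      Φ.φ ((Φ.stpC t ℓ i)^[k] v).1 = Φ.φ v.1 + Pi.single i (k : ℤ) ∧
      (∀ w ∈ W.support, w = v ∨ ∃ j : ℕ, 1 ≤ j ∧ j ≤ k ∧ Φ.φ w.1 = Φ.φ v.1 + Pi.single i (j : ℤ)) ∧
      (∀ w ∈ W.support, w = (Φ.stpC t ℓ i)^[k] v ∨ Φ.φ w.1 - Φ.φ t ∈ box 2 ℓ) ∧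
      (∀ C : Set (Φ.cyl t (ℓ + 3)), (∀ z ∈ C, Φ.φ z.1 - Φ.φ t ∈ box 2 ℓ → Φ.stpC t ℓ 0 z ∈ C ∧ Φ.stpC t ℓ 1 z ∈ C) →
        ∀ (u : Φ.cyl t (ℓ + 3)) (hu : u ∈ W.support), u ∈ C → ∀ w ∈ (W.dropUntil u hu).support, w ∈ C) := by
  intro k
  induction k with
  | zero =>
    intro v _ _ _
    refine ⟨Walk.nil, Walk.IsPath.nil, rfl, by simp, fun w hw => Or.inl (by simpa using hw), fun w hw => Or.inl (by simpa using hw),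
      fun C _ u hu huC w hw => ?_⟩
    have huv : u = v := by simpa using hu
    subst huv
    rw [Walk.dropUntil_first] at hw
    simp only [Function.iterate_zero, id_eq, support_nil, List.mem_singleton] at hw
    exact hw ▸ huC
  | succ k ih =>
    intro v hoth hlo hhi
    -- `v` is inner, hence in `Λ_{ℓ+2}`
    have hvin : Φ.φ v.1 - Φ.φ t ∈ box 2 ℓ := by
      rw [mem_box]; intro j
      by_cases hj : j = i
      · subst hj; simp only [Pi.sub_apply]; push_cast at hhi; constructor <;> omega
      · have := hoth j hj; rw [abs_le] at this; simpa only [Pi.sub_apply] using this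
    have hvin2 : Φ.φ v.1 - Φ.φ t ∈ box 2 (ℓ + 2) := mem_box_add_two_of_mem_box hvin
    set v' : Φ.cyl t (ℓ + 3) := Φ.stpC t ℓ i v with hv'
    have hv'1 : v'.1 = Φ.stp i v.1 := Φ.stpC_val i hvin2
    have hφv'i : Φ.φ v'.1 i = Φ.φ v.1 i + 1 := by rw [hv'1, Φ.φ_stp_same]
    have hφv'j : ∀ j : Fin 2, j ≠ i → Φ.φ v'.1 j = Φ.φ v.1 j := fun j hj => by rw [hv'1, Φ.φ_stp_ne hj]
    have hφv' : Φ.φ v'.1 = Φ.φ v.1 + Pi.single i 1 := by rw [hv'1, Φ.φ_stp]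
    obtain ⟨W', hP', hlen', hend', hsup', hinn', htail'⟩ := ih v' (fun j hj => by rw [hφv'j j hj]; exact hoth j hj)
      (by rw [hφv'i]; linarith) (by rw [hφv'i]; push_cast at hhi ⊢; linarith)
    have hadj : (G.induce (Φ.cyl t (ℓ + 3))).Adj v v' := Φ.adj_stpC i hvin2
    -- support positions of `W'` relative to `v`
    have hsupv : ∀ w ∈ W'.support, ∃ j : ℕ, 1 ≤ j ∧ j ≤ k + 1 ∧ Φ.φ w.1 = Φ.φ v.1 + Pi.single i (j : ℤ) := by
      intro w hw
      rcases hsup' w hw with rfl | ⟨j, hj1, hjk, hφ⟩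
      · exact ⟨1, le_rfl, by omega, by rw [hφv']; norm_cast⟩
      · refine ⟨j + 1, by omega, by omega, ?_⟩
        rw [hφ, hφv', add_assoc, ← Pi.single_add]; push_cast; ring_nf
    have hvW' : v ∉ W'.support := by
      intro hv
      obtain ⟨j, hj1, -, hφ⟩ := hsupv v hv
      have := congrFun hφ i
      rw [Pi.add_apply, Pi.single_eq_same] at this
      omega
    refine ⟨Walk.cons hadj W', (cons_isPath_iff _ _).2 ⟨hP', hvW'⟩, by rw [length_cons]; exact congrArg (· + 1) hlen',
      ?_, fun w hw => ?_, fun w hw => ?_,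
      fun C hC u hu huC w hw => ?_⟩
    · show Φ.φ ((Φ.stpC t ℓ i)^[k] v').1 = Φ.φ v.1 + Pi.single i ((k + 1 : ℕ) : ℤ)
      rw [hend', hφv', add_assoc, ← Pi.single_add]; push_cast; ring_nf
    · rw [support_cons, List.mem_cons] at hw
      rcases hw with rfl | hw
      · exact Or.inl rfl
      · exact Or.inr (hsupv w hw)
    · rw [support_cons, List.mem_cons] at hw
      rcases hw with rfl | hw
      · exact Or.inr hvin
      · exact hinn' w hw
    · by_cases huv : u = v
      · subst huv
        rw [Walk.dropUntil_first, support_cons, List.mem_cons] at hw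
        have hv'C : v' ∈ C := by
          have := hC u huC hvin
          fin_cases i
          · exact this.1
          · exact this.2
        rcases hw with rfl | hw
        · exact huC
        · have := htail' C hC v' W'.start_mem_support hv'C w
          rw [Walk.dropUntil_first] at this
          exact this hw
      · have hu' : u ∈ W'.support := by
          rw [support_cons, List.mem_cons] at hu
          exact hu.resolve_left huv
        have hw' : w ∈ (W'.dropUntil u hu').support := by
          simpa [Walk.dropUntil, Ne.symm huv] using hw
        exact htail' C hC u hu' huC w hw'

/-! ## §3 The ray of an inner vertex -/

/-- Coordinates of a point at `φ a + j e₁`. [folklore] -/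
theorem coords_one {a w : V} {j : ℕ} (h : Φ.φ w = Φ.φ a + Pi.single 1 (j : ℤ)) : Φ.φ w 0 = Φ.φ a 0 ∧ Φ.φ w 1 = Φ.φ a 1 + j := by
  constructor
  · rw [h, Pi.add_apply, Pi.single_eq_of_ne (by decide), add_zero]
  · rw [h, Pi.add_apply, Pi.single_eq_same]

/-- Coordinates of a point at `φ a + j e₀`. [folklore] -/
theorem coords_zero {a w : V} {j : ℕ} (h : Φ.φ w = Φ.φ a + Pi.single 0 (j : ℤ)) : Φ.φ w 0 = Φ.φ a 0 + j ∧ Φ.φ w 1 = Φ.φ a 1 := by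
  constructor
  · rw [h, Pi.add_apply, Pi.single_eq_same]
  · rw [h, Pi.add_apply, Pi.single_eq_of_ne (by decide), add_zero]

/-- **Number of steps of the ray** of `x` in direction `eᵢ` until it leaves `Λ_ℓ`: `ℓ + 1 − (φᵢ x − φᵢ t)`. [folklore] -/
def rayLen (t : V) (ℓ : ℕ) (i : Fin 2) (x : Φ.cyl t (ℓ + 3)) : ℕ := ((ℓ : ℤ) + 1 - (Φ.φ x.1 i - Φ.φ t i)).toNat

/-- **THE RAY of an inner vertex** `x` in direction `eᵢ`: a path in the big cylinder graph of length `≤ 2ℓ+1`, inside `Λ_{ℓ+2}`, ending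
OUTSIDE `Λ_ℓ`; its vertices other than `x` sit at `φ x + j eᵢ`, `j ≥ 1`; its tails above vertices of an up-closed set stay in the set, and
the whole ray lies in any up-closed set containing `x`. [cite: KozmaNitzan2024, §4 p. 26 ((29))] -/
theorem exists_rayC (i : Fin 2) (x : Φ.cyl t (ℓ + 3)) (hx : Φ.φ x.1 - Φ.φ t ∈ box 2 ℓ) :
    ∃ (p : Φ.cyl t (ℓ + 3)) (W : (G.induce (Φ.cyl t (ℓ + 3))).Walk x p), W.IsPath ∧ W.length ≤ 2 * ℓ + 1 ∧
      (∀ w ∈ W.support, w = x ∨ ∃ j : ℕ, 1 ≤ j ∧ Φ.φ w.1 = Φ.φ x.1 + Pi.single i (j : ℤ)) ∧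
      (∀ w ∈ W.support, Φ.φ w.1 - Φ.φ t ∈ box 2 (ℓ + 2)) ∧
      Φ.φ p.1 - Φ.φ t ∉ box 2 ℓ ∧
      (∀ w ∈ W.support, w = p ∨ Φ.φ w.1 - Φ.φ t ∈ box 2 ℓ) ∧
      (∀ C : Set (Φ.cyl t (ℓ + 3)), (∀ z ∈ C, Φ.φ z.1 - Φ.φ t ∈ box 2 ℓ → Φ.stpC t ℓ 0 z ∈ C ∧ Φ.stpC t ℓ 1 z ∈ C) →
        ∀ (u : Φ.cyl t (ℓ + 3)) (hu : u ∈ W.support), u ∈ C → ∀ w ∈ (W.dropUntil u hu).support, w ∈ C) ∧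
      (∀ C : Set (Φ.cyl t (ℓ + 3)), (∀ z ∈ C, Φ.φ z.1 - Φ.φ t ∈ box 2 ℓ → Φ.stpC t ℓ 0 z ∈ C ∧ Φ.stpC t ℓ 1 z ∈ C) →
        x ∈ C → ∀ w ∈ W.support, w ∈ C) := by
  have hx2 := mem_box.1 hx
  have hxi := hx2 i
  simp only [Pi.sub_apply] at hxi
  have hk : (Φ.rayLen t ℓ i x : ℤ) = (ℓ : ℤ) + 1 - (Φ.φ x.1 i - Φ.φ t i) := by
    rw [rayLen, Int.toNat_of_nonneg (by omega)]
  obtain ⟨W, hP, hlen, hend, hsup, hinn, htail⟩ := Φ.exists_rayWalk i (Φ.rayLen t ℓ i x) x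
    (fun j _ => by have := hx2 j; simp only [Pi.sub_apply] at this; exact abs_le.2 this) hxi.1 (by rw [hk]; linarith)
  refine ⟨_, W, hP, by zify; rw [hlen, hk]; linarith, fun w hw => ?_, fun w hw => ?_, ?_, hinn, htail, fun C hC hxC w hw => ?_⟩
  · rcases hsup w hw with h | ⟨j, hj1, -, hφ⟩
    · exact Or.inl h
    · exact Or.inr ⟨j, hj1, hφ⟩
  · rcases hsup w hw with rfl | ⟨j, -, hjk, hφ⟩
    · exact mem_box_add_two_of_mem_box hx
    · rw [mem_box]; intro j'
      simp only [Pi.sub_apply]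
      by_cases hj' : j' = i
      · subst hj'; rw [hφ, Pi.add_apply, Pi.single_eq_same]
        have hjk' : (j : ℤ) ≤ Φ.rayLen t ℓ j' x := by exact_mod_cast hjk
        push_cast; constructor <;> linarith
      · rw [hφ, Pi.add_apply, Pi.single_eq_of_ne hj', add_zero]
        have := hx2 j'; simp only [Pi.sub_apply] at this; push_cast; constructor <;> linarith [this.1, this.2]
  · intro hin
    have := (mem_box.1 hin) i
    simp only [Pi.sub_apply] at this
    rw [hend, Pi.add_apply, Pi.single_eq_same] at this
    linarith [this.2]
  · have := htail C hC x W.start_mem_support hxC w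
    rw [Walk.dropUntil_first] at this
    exact this hw

/-! ## §4 A north ray and an east ray are disjoint -/

/-- **Disjointness of a NORTH ray (from `a`) and an EAST ray (from `b`)** under the coordinate condition. [folklore] -/
theorem ray_disjoint {a b w : Φ.cyl t (ℓ + 3)}
    (h : Φ.φ a.1 0 < Φ.φ b.1 0 ∨ Φ.φ b.1 1 < Φ.φ a.1 1 ∨ (Φ.φ a.1 = Φ.φ b.1 ∧ a ≠ b))
    (hwa : w = a ∨ ∃ j : ℕ, 1 ≤ j ∧ Φ.φ w.1 = Φ.φ a.1 + Pi.single 1 (j : ℤ))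
    (hwb : w = b ∨ ∃ j : ℕ, 1 ≤ j ∧ Φ.φ w.1 = Φ.φ b.1 + Pi.single 0 (j : ℤ)) : False := by
  -- coordinates of `w` seen from `a` and from `b`
  obtain ⟨ja, ha0, ha1, hja⟩ : ∃ ja : ℕ, Φ.φ w.1 0 = Φ.φ a.1 0 ∧ Φ.φ w.1 1 = Φ.φ a.1 1 + ja ∧ (w = a ∨ 1 ≤ ja) := by
    rcases hwa with rfl | ⟨j, hj, hφ⟩
    · exact ⟨0, rfl, by simp, Or.inl rfl⟩
    · exact ⟨j, (Φ.coords_one hφ).1, (Φ.coords_one hφ).2, Or.inr hj⟩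
  obtain ⟨jb, hb0, hb1, hjb⟩ : ∃ jb : ℕ, Φ.φ w.1 0 = Φ.φ b.1 0 + jb ∧ Φ.φ w.1 1 = Φ.φ b.1 1 ∧ (w = b ∨ 1 ≤ jb) := by
    rcases hwb with rfl | ⟨j, hj, hφ⟩
    · exact ⟨0, by simp, rfl, Or.inl rfl⟩
    · exact ⟨j, (Φ.coords_zero hφ).1, (Φ.coords_zero hφ).2, Or.inr hj⟩
  rcases h with h | h | ⟨hφ, hab⟩
  · omega
  · omega
  · have h0 := congrFun hφ 0
    have h1 := congrFun hφ 1
    rcases hja with rfl | hja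
    · rcases hjb with rfl | hjb
      · exact hab rfl
      · omega
    · omega

/-- **Who goes north** — one of the two orders of a pair always satisfies the rule "`φ₀ a < φ₀ b`, or `φ₀ a = φ₀ b` and
`φ₁ b ≤ φ₁ a`" (then `a` takes the north ray and `b` the east ray). [folklore] -/
theorem north_cases (a b : V) :
    (Φ.φ a 0 < Φ.φ b 0 ∨ (Φ.φ a 0 = Φ.φ b 0 ∧ Φ.φ b 1 ≤ Φ.φ a 1)) ∨
      (Φ.φ b 0 < Φ.φ a 0 ∨ (Φ.φ b 0 = Φ.φ a 0 ∧ Φ.φ a 1 ≤ Φ.φ b 1)) := by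
  omega

/-- The rule with `a ≠ b` gives the disjointness condition for (north ray of `a`, east ray of `b`). [folklore] -/
theorem cond_of_north {a b : Φ.cyl t (ℓ + 3)} (hab : a ≠ b)
    (h : Φ.φ a.1 0 < Φ.φ b.1 0 ∨ (Φ.φ a.1 0 = Φ.φ b.1 0 ∧ Φ.φ b.1 1 ≤ Φ.φ a.1 1)) :
    Φ.φ a.1 0 < Φ.φ b.1 0 ∨ Φ.φ b.1 1 < Φ.φ a.1 1 ∨ (Φ.φ a.1 = Φ.φ b.1 ∧ a ≠ b) := by
  rcases h with h | ⟨h0, h1⟩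
  · exact Or.inl h
  · rcases h1.lt_or_eq with h1 | h1
    · exact Or.inr (Or.inl h1)
    · refine Or.inr (Or.inr ⟨?_, hab⟩)
      ext j
      fin_cases j
      · exact h0
      · exact h1.symm

end Cyl

end PlanarSkeletonFrm

end Summit.CriticalPhenomena.PercolationContinuityZ3.Theorems.Transplant

end
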